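import Summits.BirchSwinnertonDyer.BirchSwinnertonDyer.Theses.TameQuarticManinParity
import Summits.BirchSwinnertonDyer.BirchSwinnertonDyer.Theses.TameQuarticSolvent
import Summits.BirchSwinnertonDyer.BirchSwinnertonDyer.Theorems.ManinLocalTwoThreeCDivisionIntegralCDT
import Summits.BirchSwinnertonDyer.BirchSwinnertonDyer.Theorems.EdixhovenFibreFiveSevenStarredOptimalManinUnitFiveSevenCdtThm1
import Summits.BirchSwinnertonDyer.Rank1Residual.Additive.KatoDescentRankOneCountContraOfFacts
import HarnessLib

/-!
# Route `TameQuarticManinParity`: its nine Manin-unit items at `p = 3` on the class (t′) — 23736, 23737, 24498, 24499,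
# 24627, 24628, 24070, 24046, 27753 — closed by name (and the two decls shared with `TameQuarticSolvent`)

Cell `pub/bsd-wall`, seat `bsd-line-edix-p4` g41 (cross-route closer; the route pen is bsd-idea-3; no seat holds these items,
all unclaimed at filing).  THEOREMS ONLY (no definition, no named fact, no instance, no `sorry`).

WHAT.  The sibling seat ttd-p1 g31 landed `TameQuarticManinParityOfCDT.*` (file `TameQuarticManinParityCellsOfCDT`): every
Manin-unit item of this route follows from ONE lemma, `p ∤ c(D)` at every lattice-optimal conductor-level datum of a globally
minimal curve additive at an odd prime `p` — `p² ∣ N(W)` at an additive place (`Additive.ContraCount.sq_dvd_conductorNorm_of_addv`)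
and `|c| = 1` at a level with an odd square factor — keyed on the Remark-58/59 reading
`CalegariDimitrovTang2025_unboundedDenominators_algInt`.  The cell bsd-f2-manin re-ran its `c`-division chain from THEOREM 1.0.1
AS PRINTED (`ManinLocalTwoThree.CDivisionInt.abs_maninConstant_eq_one_of_CDTInt_of_odd_sq_dvd`, integer coefficients), and that
printed theorem is now the tree theorem `calegariDimitrovTang2025_unboundedDenominators_holds` (p826028; line `cdt_thm1` of crux
K★ of route EdixhovenFibreFiveSeven: CDT Cor. 4.5.3 in invariant form for all levels, Ihara amalgam + CSP, Prop. 3.0.1,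
(4.3.3), rationality — all kernel-checked, standard axioms).  §1 is the Theorem-1 twin of ttd-p1's lemma with the key
DISCHARGED; §2 proves the nine route decls by name, verbatim the proofs of `TameQuarticManinParityOfCDT` (every class /
degree / Kodaira clause idle); §3 the two `TameQuarticSolvent` twins (bodies identical, hence definitionally equal).

HONEST STATUS.  No W-ALL class theorem is proved: the rung `WAllExclAddTprimeAtThreeRankOne` still needs `PublishedInputGZK`
(19921, hypothesis-only) and the two XL halves `TprimeHeegnerUpperOfManinUnit` (23738) / `TprimeRankOneLowerAtThree` (23739).
BSD is NOT proved by this; Manin's conjecture is not announced by this (the chain rests on the tree's vendored definitions of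
`ModularParametrizationData` / `periodLattice` / `maninConstant`, which deserve the refuters' audit now that the CDT key is a
theorem).  [cite: CalegariDimitrovTang2025, Thm. 1.0.1] [cite: LingOesterle1991, Thm. 6] [cite: Silverman1994, IV.10.2(c)]
-/

set_option autoImplicit false
-- the Theorems namespace of a single-conjunct summit repeats the summit name by design (D-0017)
set_option linter.dupNamespace false

noncomputable section

open scoped Classical

open WeierstrassCurve Literature.NumberTheory.EllipticCurves Literature.NumberTheory.EllipticCurves.ModularForms
  Literature.NumberTheory.EllipticCurves.Rank1Residual
  Summit.BirchSwinnertonDyer.Rank1Residual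
  Summit.BirchSwinnertonDyer.BirchSwinnertonDyer.Theses
  Summit.BirchSwinnertonDyer.BirchSwinnertonDyer.Theorems

namespace Summit.BirchSwinnertonDyer.BirchSwinnertonDyer.Theorems.TameQuarticManinParityCdtThm1

/-! ### §1 Manin's `p`-part at a conductor-level lattice-optimal datum, any odd additive `p` — UNCONDITIONAL -/

/-- **`p ∤ c(D)` at every lattice-optimal conductor-level datum of every globally minimal curve additive at an odd prime `p`**
(in particular `p = 3`).  `p² ∣ N(W)` at an additive place, then `|c| = 1` at a level with an odd square factor by the integer
`c`-division chain from CDT Theorem 1.0.1 (`CDivisionInt.abs_maninConstant_eq_one_of_CDTInt_of_odd_sq_dvd` applied to the tree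
theorem `calegariDimitrovTang2025_unboundedDenominators_holds`).  The Theorem-1 twin of
`TameQuarticManinParityOfCDT.not_dvd_maninConstant_of_CDT_of_addv` with its key discharged; the rest of the proof is verbatim.
Manin's conjecture and BSD are not proved by this. [cite: CalegariDimitrovTang2025, Thm. 1.0.1] [cite: LingOesterle1991, Thm. 6]
[cite: Silverman1994, IV.10.2(c)] -/
theorem not_dvd_maninConstant_of_addv
    {W : WeierstrassCurve ℚ} [W.IsElliptic] [W.IsGloballyMinimal] [NeZero (W.conductorNorm ℤ)]
    (D : ModularParametrizationData W (W.conductorNorm ℤ)) {p : ℕ} [Fact p.Prime] (hp3 : 3 ≤ p) (hadd : Addv W p)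
    (hlat : ∀ z ∈ D.L.lattice, ∃ w ∈ periodLattice D.f, z = D.c * w) : ¬ (p : ℤ) ∣ D.maninConstant := by
  have hp : p.Prime := Fact.out
  have h1 : |D.maninConstant| = 1 :=
    ManinLocalTwoThree.CDivisionInt.abs_maninConstant_eq_one_of_CDTInt_of_odd_sq_dvd
      calegariDimitrovTang2025_unboundedDenominators_holds D hlat hp hp3
      (Additive.ContraCount.sq_dvd_conductorNorm_of_addv W p hadd)
  intro hpc
  have hdvd : (p : ℤ) ∣ |D.maninConstant| := (dvd_abs (p : ℤ) D.maninConstant).mpr hpc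
  rw [h1] at hdvd
  have hp1 : p ∣ 1 := by exact_mod_cast hdvd
  exact hp.ne_one (Nat.dvd_one.mp hp1)

/-! ### §2 The route's nine Manin-unit items at `3`, BY NAME -/

/-- **Crux 2 `TprimeIrreducibleManinUnit` (stmt-BirchSwinnertonDyer-23736), proved by name** (non-CM, `SubTprime`, `E[3]`
irreducible, degree-minimality idle): `3 ∤ c` — `not_dvd_maninConstant_of_addv`.  BSD is NOT proved by this.
[cite: CalegariDimitrovTang2025, Thm. 1.0.1] -/
theorem TprimeIrreducibleManinUnit_proof : TameQuarticManinParity.TprimeIrreducibleManinUnit := by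
  intro W _ _ _ _hCM hadd _hsub _hirr D hlat _hmin
  exact not_dvd_maninConstant_of_addv D le_rfl hadd hlat

/-- **Crux 3 `TprimeReducibleManinUnit` (stmt-BirchSwinnertonDyer-23737), proved by name** (the reducible rows; clauses idle).
BSD is NOT proved by this. [cite: CalegariDimitrovTang2025, Thm. 1.0.1] -/
theorem TprimeReducibleManinUnit_proof : TameQuarticManinParity.TprimeReducibleManinUnit := by
  intro W _ _ _ _hCM hadd _hsub _hred D hlat _hmin
  exact not_dvd_maninConstant_of_addv D le_rfl hadd hlat

/-- **`TprimeIrrManinUnitOfThreeDvdDegree` (stmt-BirchSwinnertonDyer-24498, the `3 ∣ deg` child of crux 2), proved by name.**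
BSD is NOT proved by this. [cite: CalegariDimitrovTang2025, Thm. 1.0.1] -/
theorem TprimeIrrManinUnitOfThreeDvdDegree_proof : TameQuarticManinParity.TprimeIrrManinUnitOfThreeDvdDegree := by
  intro W _ _ _ _hCM hadd _hsub _hirr D hlat _hmin _hdeg
  exact not_dvd_maninConstant_of_addv D le_rfl hadd hlat

/-- **`TprimeIrrManinUnitOfDegreePrimeToThree` (stmt-BirchSwinnertonDyer-24499, the `3 ∤ deg` child of crux 2), proved by name.**
BSD is NOT proved by this. [cite: CalegariDimitrovTang2025, Thm. 1.0.1] -/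
theorem TprimeIrrManinUnitOfDegreePrimeToThree_proof : TameQuarticManinParity.TprimeIrrManinUnitOfDegreePrimeToThree := by
  intro W _ _ _ _hCM hadd _hsub _hirr D hlat _hmin _hdeg
  exact not_dvd_maninConstant_of_addv D le_rfl hadd hlat

/-- **`TprimeRedManinUnitOfThreeDvdDegree` (stmt-BirchSwinnertonDyer-24627, the `3 ∣ deg` child of crux 3), proved by name.**
BSD is NOT proved by this. [cite: CalegariDimitrovTang2025, Thm. 1.0.1] -/
theorem TprimeRedManinUnitOfThreeDvdDegree_proof : TameQuarticManinParity.TprimeRedManinUnitOfThreeDvdDegree := by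
  intro W _ _ _ _hCM hadd _hsub _hred D hlat _hmin _hdeg
  exact not_dvd_maninConstant_of_addv D le_rfl hadd hlat

/-- **`TprimeRedManinUnitOfDegreePrimeToThree` (stmt-BirchSwinnertonDyer-24628, the `3 ∤ deg` child of crux 3), proved by
name.**  BSD is NOT proved by this. [cite: CalegariDimitrovTang2025, Thm. 1.0.1] -/
theorem TprimeRedManinUnitOfDegreePrimeToThree_proof : TameQuarticManinParity.TprimeRedManinUnitOfDegreePrimeToThree := by
  intro W _ _ _ _hCM hadd _hsub _hred D hlat _hmin _hdeg
  exact not_dvd_maninConstant_of_addv D le_rfl hadd hlat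

/-- **`TprimeTameThreeOptimalManinUnit` (stmt-BirchSwinnertonDyer-24070: Kodaira III at `3`, `ord₃ Δ = 3`, `3 ∣ deg), proved by
name.**  BSD is NOT proved by this. [cite: CalegariDimitrovTang2025, Thm. 1.0.1] -/
theorem TprimeTameThreeOptimalManinUnit_proof : TameQuarticManinParity.TprimeTameThreeOptimalManinUnit := by
  intro W _ _ _ hadd _hsub _hv D hlat _hmin _hdeg
  exact not_dvd_maninConstant_of_addv D le_rfl hadd hlat

/-- **`TprimeTameStarredOptimalManinUnit` (stmt-BirchSwinnertonDyer-24046: the starred partner III*, `ord₃ Δ = 9`), proved by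
name.**  BSD is NOT proved by this. [cite: CalegariDimitrovTang2025, Thm. 1.0.1] -/
theorem TprimeTameStarredOptimalManinUnit_proof : TameQuarticManinParity.TprimeTameStarredOptimalManinUnit := by
  intro W _ _ _ hadd _hsub _hv D hlat _hmin
  exact not_dvd_maninConstant_of_addv D le_rfl hadd hlat

/-- **`TprimeRedKodairaThreeManinUnitOfThreeDvdDegree` (stmt-BirchSwinnertonDyer-27753: reducible, `ord₃ Δ = 3`, `3 ∣ deg`),
proved by name.**  BSD is NOT proved by this. [cite: CalegariDimitrovTang2025, Thm. 1.0.1] -/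
theorem TprimeRedKodairaThreeManinUnitOfThreeDvdDegree_proof :
    TameQuarticManinParity.TprimeRedKodairaThreeManinUnitOfThreeDvdDegree := by
  intro W _ _ _ _hCM hadd _hsub _hred D hlat _hmin _hv _hdeg
  exact not_dvd_maninConstant_of_addv D le_rfl hadd hlat

/-! ### §3 The two decls shared verbatim with route `TameQuarticSolvent` (same items 23736 / 23737) -/

/-- **Crux `TprimeIrreducibleManinUnit` in route TameQuarticSolvent's namespace** (item stmt-BirchSwinnertonDyer-23736; body
identical to TameQuarticManinParity's, so definitionally equal).  BSD is NOT proved by this. [cite: CalegariDimitrovTang2025, Thm. 1.0.1] -/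
theorem TameQuarticSolvent_TprimeIrreducibleManinUnit_proof : TameQuarticSolvent.TprimeIrreducibleManinUnit :=
  TprimeIrreducibleManinUnit_proof

/-- **Crux `TprimeReducibleManinUnit` in route TameQuarticSolvent's namespace** (item stmt-BirchSwinnertonDyer-23737; body
identical to TameQuarticManinParity's).  BSD is NOT proved by this. [cite: CalegariDimitrovTang2025, Thm. 1.0.1] -/
theorem TameQuarticSolvent_TprimeReducibleManinUnit_proof : TameQuarticSolvent.TprimeReducibleManinUnit :=
  TprimeReducibleManinUnit_proof

end Summit.BirchSwinnertonDyer.BirchSwinnertonDyer.Theorems.TameQuarticManinParityCdtThm1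

end
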